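import Literature.Probability.LatticeModels.MeshDomainBulk
import HarnessLib

/-!
# Uniform bulk of the largest mesh component along a convergent family of domains

Crux `Summit.CriticalPhenomena.CardyFormulaZ2.Theses.CardyUniqueLimit.CardyRigidity`
(stmt-CriticalPhenomena-0746), line `crossing_martingale`, stub `stub_slitObservableApprox`,
piece **(P-bulk)**: hypothesis (H6) of the landed flower-sandwich transfer lemma
`slitCrossing_discreteCrossing_subset_of_margins` (…SlitCrossingTransfer.lean, through
`Transfer.h6_of_bulk`) asks that the mesh vertices of the VARYING domain `Ω_k` deep inside it
belong to its largest mesh component `meshDomain Ω_k δ_k`, at a depth independent of `k`.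
The tree's `MeshDomainBulk.lean` proves the fixed-domain statement (open bounded connected `Ω`
with Lebesgue-null frontier); this file proves it UNIFORMLY along a family `Ω_k` converging to
such an `Ω` in the metric sandwich sense

    ∀ ε > 0, eventually:  {z ∈ Ω | ε ≤ infDist z Ωᶜ} ⊆ Ω_k ⊆ {z | infDist z Ω < ε},

with meshes `δ_k → 0` (any filter):

* `Bulk.eventually_forall_mem_meshDomain_of_sandwich` — for every compact `K ⊆ Ω`, eventually
  every lattice point of `δ_k ℤ²` with mesh point in `K` lies in `meshDomain Ω_k δ_k`, which is
  a single mesh component.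

Proof: the fixed-domain counting of `MeshDomainBulk.lean` with constants taken from the LIMIT
domain `Ω`: the lattice points of `Ω` at distance `≥ ε` from `Ωᶜ` lie in `Ω_k` (inner
containment) and in one mesh component of `Ω_k` (bulk neighbourhood of `Ω`, whose `ρ/2`-balls
lie in `Ω_k`), and they are `≥ (area Ω - o(1)) / area B(0, δ)` many; every other mesh vertex of
`Ω_k` is within `ε` of `Ωᶜ` or outside `Ω` but within `ε` of `Ω` (outer containment), and the
disjoint `δ/2`-balls about those fit into (inner collar) ∪ `∂Ω` ∪ (outer collar), of area `o(1)`.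
No source states it; recorded as folklore (cf. Camia–Newman 2007, proof of Thm 3, where the
discretisations of the approximating domains are tacitly in the bulk).
-/

namespace Summit.CriticalPhenomena.CardyFormulaZ2.Cruxes.CardyRigidity.CrossingMartingale

namespace Bulk

open Set Metric MeasureTheory Filter Topology
open Literature.Probability.LatticeModels

noncomputable section

/-- The segment from a point of the open set `Ω` to a point outside it meets `∂Ω`. [folklore] -/
theorem exists_mem_segment_mem_frontier {Ω : Set ℂ} (hΩo : IsOpen Ω) {p q₀ : ℂ}
    (hp : p ∉ Ω) (hq₀ : q₀ ∈ Ω) : ∃ q ∈ segment ℝ q₀ p, q ∈ frontier Ω := by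
  by_contra! hcon
  refine hp ((convex_segment q₀ p).isPreconnected.subset_of_closure_inter_subset
    hΩo ⟨q₀, left_mem_segment ℝ _ _, hq₀⟩ ?_ (right_mem_segment ℝ _ _))
  rintro w ⟨hwc, hws⟩
  by_contra hw
  exact hcon w hws ⟨hwc, by rwa [hΩo.interior_eq]⟩

/-- A point outside `Ω` is within `dist q₀ p` of the frontier of `Ω` for every `q₀ ∈ Ω`.
[folklore] -/
theorem infDist_frontier_le_dist_of_not_mem {Ω : Set ℂ} (hΩo : IsOpen Ω) {p q₀ : ℂ}
    (hp : p ∉ Ω) (hq₀ : q₀ ∈ Ω) : infDist p (frontier Ω) ≤ dist q₀ p := by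
  obtain ⟨q, hq, hqf⟩ := exists_mem_segment_mem_frontier hΩo hp hq₀
  have hqp : dist q p ≤ dist q₀ p := by
    have := dist_add_dist_of_mem_segment hq
    linarith [dist_nonneg (x := q₀) (y := q)]
  calc infDist p (frontier Ω) ≤ dist p q := infDist_le_dist_of_mem hqf
    _ ≤ dist q₀ p := by rw [dist_comm]; exact hqp

/-- A point of `Ω` is within `dist q₀ p` of the frontier of `Ω` for every `p ∉ Ω`; hence
`infDist q₀ (frontier Ω) ≤ infDist q₀ Ωᶜ`. [folklore] -/
theorem infDist_frontier_le_infDist_compl {Ω : Set ℂ} (hΩo : IsOpen Ω) (hne : Ωᶜ.Nonempty)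
    {q₀ : ℂ} (hq₀ : q₀ ∈ Ω) : infDist q₀ (frontier Ω) ≤ infDist q₀ Ωᶜ := by
  refine (le_infDist hne).2 fun p hp => ?_
  obtain ⟨q, hq, hqf⟩ := exists_mem_segment_mem_frontier hΩo hp hq₀
  have hqp : dist q₀ q ≤ dist q₀ p := by
    have := dist_add_dist_of_mem_segment hq
    linarith [dist_nonneg (x := q) (y := p)]
  exact (infDist_le_dist_of_mem hqf).trans hqp

/-- **Counting against area.** If the open `δ/2`-balls about the lattice points of a finite set
`S` all lie in a bounded set `U`, then `#S · area B(0, δ/2) ≤ area U` (the balls are pairwise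
disjoint, `le_dist_meshPoint_of_ne`). [folklore] -/
theorem ncard_mul_le_volume_real_of_ball_subset {S : Set (Site 2)} (hS : S.Finite) {U : Set ℂ}
    (hU : Bornology.IsBounded U) {δ : ℝ} (hδ : 0 < δ)
    (hSU : ∀ x ∈ S, ball (meshPoint δ x) (δ / 2) ⊆ U) :
    (S.ncard : ℝ) * ((δ / 2) ^ 2 * volume.real (ball (0 : ℂ) 1)) ≤ volume.real U := by
  have hdisj : (hS.toFinset : Set (Site 2)).PairwiseDisjoint fun x => ball (meshPoint δ x) (δ / 2) := by
    intro x _ y _ hxy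
    refine Set.disjoint_left.2 fun p hpx hpy => ?_
    have h := le_dist_meshPoint_of_ne hδ hxy
    have : dist (meshPoint δ x) (meshPoint δ y) < δ :=
      calc dist (meshPoint δ x) (meshPoint δ y) ≤ dist (meshPoint δ x) p + dist p (meshPoint δ y) :=
            dist_triangle _ _ _
        _ < δ / 2 + δ / 2 := add_lt_add (by rwa [dist_comm, ← mem_ball]) (mem_ball.1 hpy)
        _ = δ := by ring
    linarith
  have hsub : (⋃ x ∈ hS.toFinset, ball (meshPoint δ x) (δ / 2)) ⊆ U := by
    intro p hp
    simp only [mem_iUnion, Finite.mem_toFinset, exists_prop] at hp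
    obtain ⟨x, hx, hpx⟩ := hp
    exact hSU x hx hpx
  calc (S.ncard : ℝ) * ((δ / 2) ^ 2 * volume.real (ball (0 : ℂ) 1))
      = ∑ x ∈ hS.toFinset, volume.real (ball (meshPoint δ x) (δ / 2)) := by
        rw [Set.ncard_eq_toFinset_card S hS, ← nsmul_eq_mul, ← Finset.sum_const]
        refine Finset.sum_congr rfl fun x _ => ?_
        rw [← Measure.addHaar_real_closedBall_eq_addHaar_real_ball volume (meshPoint δ x) (δ / 2),
          Measure.addHaar_real_closedBall volume _ (by positivity : (0 : ℝ) ≤ δ / 2),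
          Complex.finrank_real_complex]
    _ = volume.real (⋃ x ∈ hS.toFinset, ball (meshPoint δ x) (δ / 2)) :=
        (measureReal_biUnion_finset hdisj (fun _ _ => measurableSet_ball)
          (fun _ _ => measure_ball_lt_top.ne)).symm
    _ ≤ volume.real U := measureReal_mono hsub hU.measure_lt_top.ne

/-- **Uniform bulk along a convergent family** (family version of
`exists_forall_mem_meshDomain_and_reachable`).  Let `Ω ⊆ ℂ` be open, bounded, connected with
`area (∂Ω) = 0`; let `Ω_k` be sets and `δ_k` meshes along a filter `l` with `δ_k > 0`,
`δ_k → 0`, such that for every `ε > 0`, eventually `{z ∈ Ω | ε ≤ infDist z Ωᶜ} ⊆ Ω_k` and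
`Ω_k ⊆ {z | infDist z Ω < ε}`.  Then for every compact `K ⊆ Ω`, eventually along `l`:
every lattice point of `δ_k ℤ²` with mesh point in `K` lies in `meshDomain Ω_k δ_k`, and
`meshDomain Ω_k δ_k` is a single component of the mesh graph of `Ω_k`. [folklore] -/
theorem eventually_forall_mem_meshDomain_of_sandwich {ι : Type*} {l : Filter ι} {Ω : Set ℂ}
    (hΩo : IsOpen Ω) (hΩb : Bornology.IsBounded Ω) (hΩc : IsConnected Ω)
    (hΩf : volume (frontier Ω) = 0) (Ωs : ι → Set ℂ) (δs : ι → ℝ)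
    (hδ : ∀ᶠ k in l, 0 < δs k) (hδ0 : Tendsto δs l (𝓝 0))
    (hin : ∀ ε : ℝ, 0 < ε → ∀ᶠ k in l, {z ∈ Ω | ε ≤ infDist z Ωᶜ} ⊆ Ωs k)
    (hout : ∀ ε : ℝ, 0 < ε → ∀ᶠ k in l, Ωs k ⊆ {z | infDist z Ω < ε})
    {K : Set ℂ} (hK : IsCompact K) (hKΩ : K ⊆ Ω) :
    ∀ᶠ k in l,
      (∀ x : Site 2, meshPoint (δs k) x ∈ K → x ∈ meshDomain (Ωs k) (δs k)) ∧
      (∀ x ∈ meshDomain (Ωs k) (δs k), ∀ y ∈ meshDomain (Ωs k) (δs k),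
        ∃ (hx : x ∈ meshVertices (Ωs k) (δs k)) (hy : y ∈ meshVertices (Ωs k) (δs k)),
          (meshVertexGraph (Ωs k) (δs k)).Reachable ⟨x, hx⟩ ⟨y, hy⟩) := by
  classical
  -- basic facts about `Ω`
  have hΩne : Ω.Nonempty := hΩc.nonempty
  have hΩuniv : Ω ≠ univ := fun h => NormedSpace.unbounded_univ ℝ ℂ (h ▸ hΩb)
  have hne : Ωᶜ.Nonempty := nonempty_compl.2 hΩuniv
  have hfne : (frontier Ω).Nonempty := nonempty_frontier_iff.2 ⟨hΩne, hΩuniv⟩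
  set v : ℝ := volume.real (ball (0 : ℂ) 1) with hv_def
  have hv : 0 < v :=
    ENNReal.toReal_pos (measure_ball_pos volume (0 : ℂ) one_pos).ne' measure_ball_lt_top.ne
  set m : ℝ := volume.real Ω with hm_def
  have hm : 0 < m := ENNReal.toReal_pos (hΩo.measure_pos volume hΩne).ne' hΩb.measure_lt_top.ne
  set η : ℝ := m / 10 with hη_def
  have hη : 0 < η := by positivity
  -- collars of small area
  obtain ⟨r₁, hr₁, hT⟩ := exists_pos_volume_real_innerCollar_lt hΩo hΩb hne hη
  obtain ⟨r₂, hr₂, hT'⟩ := exists_pos_volume_real_outerCollar_lt hΩb hfne hη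
  set ε : ℝ := r₁ / 2 with hε_def
  have hε : 0 < ε := by positivity
  -- the big compact `{ε ≤ infDist · Ωᶜ}` and the bulk neighbourhood `V` of `K ∪ Kbig`
  set Kbig : Set ℂ := {z | ε ≤ infDist z Ωᶜ} with hKbig_def
  have hKbigΩ : Kbig ⊆ Ω := fun z hz => by
    by_contra h
    have : infDist z Ωᶜ = 0 := infDist_zero_of_mem h
    have hz' : ε ≤ infDist z Ωᶜ := hz
    linarith
  have hKbigc : IsCompact Kbig :=
    Metric.isCompact_of_isClosed_isBounded (isClosed_le continuous_const (continuous_infDist_pt _))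
      (hΩb.subset hKbigΩ)
  obtain ⟨V, -, hVc, hKV, -, ρ, hρ, hVρ⟩ :=
    exists_isOpen_isPreconnected_bulk hΩo hΩc hne (hK.union hKbigc) (union_subset hKΩ hKbigΩ)
  -- balls of radius `ρ/2` about points of `V` lie `ρ/2`-deep inside `Ω`
  have hVdeep : ∀ w ∈ V, ball w (ρ / 2) ⊆ {z ∈ Ω | ρ / 2 ≤ infDist z Ωᶜ} := by
    intro w hw z hz
    have hwz : dist z w < ρ / 2 := mem_ball.1 hz
    have h1 : infDist w Ωᶜ ≤ infDist z Ωᶜ + dist w z := infDist_le_infDist_add_dist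
    have h2 : ρ / 2 < infDist z Ωᶜ := by rw [dist_comm] at hwz; linarith [hVρ w hw]
    refine ⟨?_, h2.le⟩
    by_contra hzΩ
    have : infDist z Ωᶜ = 0 := infDist_zero_of_mem hzΩ
    linarith
  -- eventually: small mesh, inner containment at depths `ε` and `ρ/2`, outer containment `r₂/2`
  have hsmall : ∀ᶠ k in l, δs k < min (ρ / 6) (min ε (r₂ / 2)) :=
    hδ0 (Iio_mem_nhds (by positivity))
  filter_upwards [hδ, hsmall, hin ε hε, hin (ρ / 2) (by positivity), hout (r₂ / 2) (by positivity)]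
    with k hδk hδlt hinε hinρ houtk
  set δ := δs k with hδ_def
  set Ω' := Ωs k with hΩ'_def
  have hδρ : 3 * δ ≤ ρ / 2 := by have := hδlt.le.trans (min_le_left _ _); linarith
  have hδε : δ ≤ ε := hδlt.le.trans ((min_le_right _ _).trans (min_le_left _ _))
  have hδr₂ : δ ≤ r₂ / 2 := hδlt.le.trans ((min_le_right _ _).trans (min_le_right _ _))
  have hVΩ' : ∀ w ∈ V, ball w (ρ / 2) ⊆ Ω' := fun w hw => (hVdeep w hw).trans hinρ
  -- `Ω'` is bounded (it lies in the `r₂/2`-thickening of `Ω`), so it has finitely many vertices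
  have hΩ'b : Bornology.IsBounded Ω' :=
    (hΩb.thickening (δ := r₂ / 2)).subset fun z hz => (mem_thickening_iff_infDist_lt hΩne).2 (houtk hz)
  have hfinV : (meshVertices Ω' δ).Finite := meshVertices_finite hΩ'b hδk
  set G := meshVertexGraph Ω' δ with hG_def
  set P : Set (Site 2) := {x | meshPoint δ x ∈ Ω ∧ ε ≤ infDist (meshPoint δ x) Ωᶜ} with hP_def
  set Bad : Set (Site 2) :=
    {x ∈ meshVertices Ω' δ | ¬ (meshPoint δ x ∈ Ω ∧ ε ≤ infDist (meshPoint δ x) Ωᶜ)} with hBad_def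
  have hPΩ' : ∀ x ∈ P, x ∈ meshVertices Ω' δ := fun x hx => hinε hx
  have hPV : ∀ x ∈ P, meshPoint δ x ∈ V := fun x hx => hKV (Or.inr hx.2)
  -- the lower count (in `Ω`)
  have hL := volume_real_le_ncard_mul hΩb hδk hδε
  -- the upper count: balls about `Bad` points fit into the collars and the frontier
  set T : Set ℂ := {z ∈ Ω | infDist z Ωᶜ < r₁} with hT_def
  set T' : Set ℂ := {z | z ∉ closure Ω ∧ infDist z (frontier Ω) < r₂} with hT'_def
  have hTb : Bornology.IsBounded (T ∪ frontier Ω ∪ T') := by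
    have hT'sub : T' ⊆ thickening r₂ (frontier Ω) := fun z hz =>
      (mem_thickening_iff_infDist_lt hfne).2 hz.2
    exact ((hΩb.subset fun z hz => hz.1).union (hΩb.closure.subset frontier_subset_closure)).union
      ((hΩb.closure.subset frontier_subset_closure).thickening.subset hT'sub)
  have hBadfin : Bad.Finite := hfinV.subset fun x hx => hx.1
  have hballs : ∀ x ∈ Bad, ball (meshPoint δ x) (δ / 2) ⊆ T ∪ frontier Ω ∪ T' := by
    rintro x ⟨hxΩ', hxbad⟩ p hp
    have hpx : dist p (meshPoint δ x) < δ / 2 := mem_ball.1 hp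
    -- a point of `Ω` within `r₂/2` of `δx`
    obtain ⟨q₀, hq₀, hq₀x⟩ : ∃ q₀ ∈ Ω, dist (meshPoint δ x) q₀ < r₂ / 2 := by
      have h := houtk hxΩ'
      exact (infDist_lt_iff hΩne).1 h
    by_cases hpΩ : p ∈ Ω
    · refine Or.inl (Or.inl ⟨hpΩ, ?_⟩)
      -- `infDist p Ωᶜ < ε + δ/2 < r₁`
      have h1 : infDist p Ωᶜ ≤ infDist (meshPoint δ x) Ωᶜ + dist p (meshPoint δ x) :=
        infDist_le_infDist_add_dist
      have h2 : infDist (meshPoint δ x) Ωᶜ < ε := by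
        by_cases hxΩ : meshPoint δ x ∈ Ω
        · exact lt_of_not_ge fun h => hxbad ⟨hxΩ, h⟩
        · rw [infDist_zero_of_mem (show meshPoint δ x ∈ Ωᶜ from hxΩ)]; exact hε
      have : ε + δ / 2 < r₁ := by rw [hε_def]; linarith
      linarith
    by_cases hpc : p ∈ closure Ω
    · exact Or.inl (Or.inr ⟨hpc, by rwa [hΩo.interior_eq]⟩)
    refine Or.inr ⟨hpc, ?_⟩
    calc infDist p (frontier Ω) ≤ dist q₀ p := infDist_frontier_le_dist_of_not_mem hΩo hpΩ hq₀
      _ ≤ dist q₀ (meshPoint δ x) + dist (meshPoint δ x) p := dist_triangle _ _ _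
      _ < r₂ / 2 + δ / 2 := by
          rw [dist_comm q₀ (meshPoint δ x), dist_comm (meshPoint δ x) p]; exact add_lt_add hq₀x hpx
      _ ≤ r₂ := by linarith
  have hU := ncard_mul_le_volume_real_of_ball_subset hBadfin hTb hδk hballs
  have hfr : volume.real (frontier Ω) = 0 := by simp [measureReal_def, hΩf]
  have hU' : (Bad.ncard : ℝ) * ((δ / 2) ^ 2 * v) ≤ 2 * η := by
    have h1 : volume.real (T ∪ frontier Ω ∪ T') ≤ volume.real T + volume.real (frontier Ω) +
        volume.real T' := by
      calc volume.real (T ∪ frontier Ω ∪ T') ≤ volume.real (T ∪ frontier Ω) + volume.real T' :=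
            measureReal_union_le _ _
        _ ≤ _ := by linarith [measureReal_union_le (μ := volume) T (frontier Ω)]
    linarith
  have hsplit : m ≤ volume.real {z ∈ Ω | 2 * ε ≤ infDist z Ωᶜ} + volume.real T := by
    have hcov : Ω ⊆ {z ∈ Ω | 2 * ε ≤ infDist z Ωᶜ} ∪ T := by
      intro z hz
      rcases le_or_gt (2 * ε) (infDist z Ωᶜ) with h | h
      · exact Or.inl ⟨hz, h⟩
      · exact Or.inr ⟨hz, by rw [hε_def] at h; linarith⟩
    calc m ≤ volume.real ({z ∈ Ω | 2 * ε ≤ infDist z Ωᶜ} ∪ T) :=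
          measureReal_mono hcov ((hΩb.subset (union_subset (fun z hz => hz.1)
            (fun z hz => hz.1))).measure_lt_top.ne)
      _ ≤ _ := measureReal_union_le _ _
  -- hence `#Bad < #P`
  have hcount : Bad.ncard < P.ncard := by
    have h1 : m - η ≤ (P.ncard : ℝ) * (δ ^ 2 * v) := by linarith
    have h2 : (Bad.ncard : ℝ) * (δ ^ 2 * v) ≤ 8 * η := by
      have h4 : (Bad.ncard : ℝ) * (δ ^ 2 * v) = 4 * ((Bad.ncard : ℝ) * ((δ / 2) ^ 2 * v)) := by
        ring
      linarith
    have hpos : 0 < δ ^ 2 * v := by positivity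
    have h5 : (Bad.ncard : ℝ) * (δ ^ 2 * v) < (P.ncard : ℝ) * (δ ^ 2 * v) := by
      have : 8 * η < m - η := by rw [hη_def]; linarith
      linarith
    exact_mod_cast lt_of_mul_lt_mul_right h5 hpos.le
  -- the bulk component `B`
  obtain ⟨x₀, hx₀⟩ : P.Nonempty := nonempty_of_ncard_ne_zero (by omega)
  set B : G.ConnectedComponent := G.connectedComponentMk ⟨x₀, hPΩ' x₀ hx₀⟩ with hB_def
  have hVB : ∀ x, meshPoint δ x ∈ V →
      ∃ hx : x ∈ meshVertices Ω' δ, G.connectedComponentMk ⟨x, hx⟩ = B := by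
    intro x hx
    obtain ⟨hx', hx₀', hr⟩ :=
      meshVertexGraph_reachable_of_mem_bulk hδk hδρ hVc hVΩ' hx (hPV x₀ hx₀)
    exact ⟨hx', SimpleGraph.ConnectedComponent.sound hr⟩
  -- points of any other component are `Bad`, points of `P` are in `B`
  have hCbad : ∀ C : G.ConnectedComponent, C ≠ B → Subtype.val '' C.supp ⊆ Bad := by
    rintro C hCB _ ⟨⟨x, hxΩ'⟩, hxC, rfl⟩
    refine ⟨hxΩ', fun hxP => ?_⟩
    obtain ⟨hx', hxB⟩ := hVB x (hPV x hxP)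
    rw [SimpleGraph.ConnectedComponent.mem_supp_iff] at hxC
    exact hCB (hxC.symm.trans hxB)
  have hPB : P ⊆ Subtype.val '' B.supp := fun x hx => by
    obtain ⟨hx', hxB⟩ := hVB x (hPV x hx)
    exact ⟨⟨x, hx'⟩, (SimpleGraph.ConnectedComponent.mem_supp_iff _ _).2 hxB, rfl⟩
  have hfinB : (Subtype.val '' B.supp).Finite :=
    hfinV.subset (by rintro _ ⟨y, -, rfl⟩; exact y.2)
  have hcardC : ∀ C : G.ConnectedComponent, C ≠ B → C.supp.ncard < B.supp.ncard := by
    intro C hCB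
    rw [← ncard_image_of_injective C.supp Subtype.val_injective,
      ← ncard_image_of_injective B.supp Subtype.val_injective]
    calc (Subtype.val '' C.supp).ncard ≤ Bad.ncard := ncard_le_ncard (hCbad C hCB) hBadfin
      _ < P.ncard := hcount
      _ ≤ (Subtype.val '' B.supp).ncard := ncard_le_ncard hPB hfinB
  -- so `Ω'_δ` is exactly the set of points of `B`
  have hdom : meshDomain Ω' δ = Subtype.val '' B.supp := by
    ext x
    simp only [meshDomain, mem_iUnion, mem_image]
    constructor
    · rintro ⟨C, hCmax, y, hyC, rfl⟩
      have hCB : C = B := by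
        by_contra hCB
        exact (hcardC C hCB).not_ge (hCmax B)
      subst hCB
      exact ⟨y, hyC, rfl⟩
    · rintro ⟨y, hyB, rfl⟩
      refine ⟨B, fun C' => ?_, y, hyB, rfl⟩
      by_cases hC'B : C' = B
      · rw [hC'B]
      · exact (hcardC C' hC'B).le
  refine ⟨fun x hxK => ?_, fun x hx y hy => ?_⟩
  · rw [hdom]
    obtain ⟨hx', hxB⟩ := hVB x (hKV (Or.inl hxK))
    exact ⟨⟨x, hx'⟩, (SimpleGraph.ConnectedComponent.mem_supp_iff _ _).2 hxB, rfl⟩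
  · rw [hdom] at hx hy
    obtain ⟨⟨x', hx'⟩, hxB, rfl⟩ := hx
    obtain ⟨⟨y', hy'⟩, hyB, rfl⟩ := hy
    refine ⟨hx', hy', ?_⟩
    rw [SimpleGraph.ConnectedComponent.mem_supp_iff] at hxB hyB
    exact SimpleGraph.ConnectedComponent.exact (hxB.trans hyB.symm)

/-- **Depth form** (the shape consumed by `Transfer.h6_of_bulk`).  Under the sandwich
hypotheses and, in addition, `∂Ω` eventually within `ε` of `∂Ω_k` for every `ε > 0`, for every
depth `m₂ > 0`, eventually along `l`: every mesh vertex of `Ω_k` at distance `≥ m₂` from `∂Ω_k`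
lies in the largest mesh component `meshDomain Ω_k δ_k`. [folklore] -/
theorem eventually_mem_meshDomain_of_depth {ι : Type*} {l : Filter ι} {Ω : Set ℂ}
    (hΩo : IsOpen Ω) (hΩb : Bornology.IsBounded Ω) (hΩc : IsConnected Ω)
    (hΩf : volume (frontier Ω) = 0) (Ωs : ι → Set ℂ) (δs : ι → ℝ)
    (hδ : ∀ᶠ k in l, 0 < δs k) (hδ0 : Tendsto δs l (𝓝 0))
    (hin : ∀ ε : ℝ, 0 < ε → ∀ᶠ k in l, {z ∈ Ω | ε ≤ infDist z Ωᶜ} ⊆ Ωs k)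
    (hout : ∀ ε : ℝ, 0 < ε → ∀ᶠ k in l, Ωs k ⊆ {z | infDist z Ω < ε})
    (hfr : ∀ ε : ℝ, 0 < ε → ∀ᶠ k in l, frontier Ω ⊆ {z | infDist z (frontier (Ωs k)) < ε})
    {m₂ : ℝ} (hm₂ : 0 < m₂) :
    ∀ᶠ k in l, ∀ v : Site 2, meshPoint (δs k) v ∈ Ωs k →
      m₂ ≤ infDist (meshPoint (δs k) v) (frontier (Ωs k)) → v ∈ meshDomain (Ωs k) (δs k) := by
  have hΩne : Ω.Nonempty := hΩc.nonempty
  have hΩuniv : Ω ≠ univ := fun h => NormedSpace.unbounded_univ ℝ ℂ (h ▸ hΩb)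
  have hne : Ωᶜ.Nonempty := nonempty_compl.2 hΩuniv
  have hfne : (frontier Ω).Nonempty := nonempty_frontier_iff.2 ⟨hΩne, hΩuniv⟩
  set K : Set ℂ := {z | m₂ / 2 ≤ infDist z Ωᶜ} with hK_def
  have hKΩ : K ⊆ Ω := fun z hz => by
    by_contra h
    have : infDist z Ωᶜ = 0 := infDist_zero_of_mem h
    have hz' : m₂ / 2 ≤ infDist z Ωᶜ := hz
    linarith
  have hKc : IsCompact K :=
    Metric.isCompact_of_isClosed_isBounded (isClosed_le continuous_const (continuous_infDist_pt _))
      (hΩb.subset hKΩ)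
  filter_upwards [eventually_forall_mem_meshDomain_of_sandwich hΩo hΩb hΩc hΩf Ωs δs hδ hδ0 hin
    hout hKc hKΩ, hout (m₂ / 4) (by positivity), hfr (m₂ / 4) (by positivity)]
    with k hk houtk hfrk v hv hdeep
  refine hk.1 v ?_
  set z := meshPoint (δs k) v with hz_def
  have hfne' : (frontier (Ωs k)).Nonempty := by
    by_contra h
    rw [not_nonempty_iff_eq_empty] at h
    rw [h, infDist_empty] at hdeep
    linarith
  -- (1) `z` is far from `∂Ω`
  have h1 : m₂ - m₂ / 4 ≤ infDist z (frontier Ω) := by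
    refine (le_infDist hfne).2 fun q hq => ?_
    obtain ⟨q', hq', hqq'⟩ := (infDist_lt_iff hfne').1 (hfrk hq : infDist q (frontier (Ωs k)) < m₂ / 4)
    have h := (le_infDist hfne').1 hdeep hq'
    linarith [dist_triangle z q q']
  -- (2) `z ∈ Ω`
  have h2 : z ∈ Ω := by
    by_contra hzΩ
    obtain ⟨q₀, hq₀, hq₀z⟩ := (infDist_lt_iff hΩne).1 (houtk hv : infDist z Ω < m₂ / 4)
    have := infDist_frontier_le_dist_of_not_mem hΩo hzΩ hq₀
    rw [dist_comm] at this
    linarith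
  -- (3) hence deep inside `Ω`
  show m₂ / 2 ≤ infDist z Ωᶜ
  linarith [infDist_frontier_le_infDist_compl hΩo hne h2]

end

end Bulk

/-- **Registered form** (glue `bulk_eventually_forall_mem_meshDomain_of_sandwich` of stmt-CriticalPhenomena-0746):
uniform bulk of the largest mesh component along a family of domains converging to an open bounded connected
domain with Lebesgue-null frontier in the metric sandwich sense, meshes `→ 0`. [folklore] -/
theorem bulk_eventually_forall_mem_meshDomain_of_sandwich : ∀ {ι : Type*} {l : Filter ι} {Ω : Set ℂ}, IsOpen Ω → Bornology.IsBounded Ω → IsConnected Ω → MeasureTheory.volume (frontier Ω) = 0 → ∀ (Ωs : ι → Set ℂ) (δs : ι → ℝ), (∀ᶠ k in l, 0 < δs k) → Filter.Tendsto δs l (nhds 0) → (∀ ε : ℝ, 0 < ε → ∀ᶠ k in l, {z ∈ Ω | ε ≤ Metric.infDist z Ωᶜ} ⊆ Ωs k) → (∀ ε : ℝ, 0 < ε → ∀ᶠ k in l, Ωs k ⊆ {z | Metric.infDist z Ω < ε}) → ∀ {K : Set ℂ}, IsCompact K → K ⊆ Ω → ∀ᶠ k in l, (∀ x : Literature.Probability.LatticeModels.Site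 2, Literature.Probability.LatticeModels.meshPoint (δs k) x ∈ K → x ∈ Literature.Probability.LatticeModels.meshDomain (Ωs k) (δs k)) ∧ (∀ x ∈ Literature.Probability.LatticeModels.meshDomain (Ωs k) (δs k), ∀ y ∈ Literature.Probability.LatticeModels.meshDomain (Ωs k) (δs k), ∃ (hx : x ∈ Literature.Probability.LatticeModels.meshVertices (Ωs k) (δs k)) (hy : y ∈ Literature.Probability.LatticeModels.meshVertices (Ωs k) (δs k)), (Literature.Probability.LatticeModels.meshVertexGraph (Ωs k) (δs k)).Reachable ⟨x, hx⟩ ⟨y, hy⟩) :=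
  fun hΩo hΩb hΩc hΩf Ωs δs hδ hδ0 hin hout _ hK hKΩ ↦
    Bulk.eventually_forall_mem_meshDomain_of_sandwich hΩo hΩb hΩc hΩf Ωs δs hδ hδ0 hin hout hK hKΩ

end Summit.CriticalPhenomena.CardyFormulaZ2.Cruxes.CardyRigidity.CrossingMartingale
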